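import Summits.QuantumFields.YangMills.Theorems.PencilRigidityHypercubicLimitCondMeanLocality
import Summits.QuantumFields.YangMills.Theorems.HypercubicLimit.Negative.TelescopingGuards
import Literature.MathematicalPhysics.QuantumLattice.TorusWilsonGibbs
import Literature.MathematicalPhysics.QuantumLattice.TorusWilsonMarkov
import Literature.MathematicalPhysics.QuantumLattice.TorusCubeSeparation
import HarnessLib

/-!
# Crux `HypercubicLimit` (stmt-QuantumFields-16154), line `peel-and-disseminate` (c1 seat): the peeling inequality

Support file (`--supports stmt-QuantumFields-16154`) proving the registered sub-goal `stub_peelIdentity` of the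
line `peel-and-disseminate` (skeleton `Cruxes/HypercubicLimit/Lines/peel_and_disseminate.lean`, §1): PEELING as
an exact inequality in tree vocabulary.  On the torus of side `2S+1` with Wilson's measure `μ`, for `n` centred
plaquettes `δpₖ` at base points `xₖ` pairwise separated by more than `2λR+1` and at most `S` in some coordinate
(`4λR+4 < 2S+1`, `λ ≥ 1`),
`|E ∏ₖ δpₖ| ≤ E ∏ₖ E[ |E[δpₖ | exterior of Q_R(xₖ)]| | exterior of Q_{λR}(xₖ) ]`.

Proof route (Markov property of the nearest-neighbour plaquette action, twice):
1. telescoping at radius `R` (`integral_prod_eq_integral_prod_of_ae_eq_condExp`) through bounded truncations of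
   the local versions of the conditional means `E[δpₖ | ext Q_R(xₖ)]` supplied by the landed
   `stub_condMeanLocality` (measurable inside `Q_{R+1}(xₖ)`, cubes separated on the torus by
   `image_torusEdge_linkCube_succ_subset_compl`): `E ∏ δpₖ = E ∏ g̃ₖ`;
2. `|E ∏ g̃ₖ| ≤ E ∏ |g̃ₖ|`;
3. telescoping once more at radius `λR` for the bounded observables `|g̃ₖ|` (measurable inside
   `Q_{R+1}(xₖ) ⊆ Q_{λR+1}(xₖ)`), the versions of `E[|g̃ₖ| | ext Q_{λR}(xₖ)]` measurable inside `Q_{λR+1}(xₖ)`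
   being the plaquette-specification kernel averages (`stronglyMeasurable_and_ae_eq_condExp_integral_gibbsSpecOfPotential`,
   `isGibbsMeasure_wilsonMeasure`);
4. `g̃ₖ = E[δpₖ | ext Q_R(xₖ)]` a.e., so the last integrand is the stated one a.e. (`condExp_congr_ae`).

Refs: Georgii 2011 Rem. 1.24, (2.11) (DLR states and the Markov property); Friedli–Velenik 2017 §6.3; Seiler LNP 159
Ch. 2; Williams 1991 §9.7 (tower property, pull-out); card `Cruxes/HypercubicLimit/Ideas/peel-and-disseminate.md`.
-/

set_option autoImplicit false

noncomputable section

open scoped SchwartzMap ENNReal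
open MeasureTheory Filter Topology
open Literature.MathematicalPhysics.AQFT Literature.MathematicalPhysics.QuantumLattice
open Literature.MathematicalPhysics.QuantumFieldTheory
open Literature.Probability.LatticeModels (box Site)
open Summit.QuantumFields.YangMills.Theorems.HypercubicLimit.Negative (torusPlaquette rpSquare influence exterior
  cubeEdgesT)

namespace Summit.QuantumFields.YangMills.Cruxes.HypercubicLimit.PeelAndDisseminate

/-! ## Markov locality for bounded observables of a cube -/

/-- **Local versions of conditional means of cube observables** (Markov property of the torus Wilson state;
Georgii 2011 Rem. 1.24 with (2.11), Friedli–Velenik 2017 §6.3): on the torus of side `2S+1`, a bounded observable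
`X` measurable inside the cube `Q_{R+1}(c)` has a version of its conditional mean given the links off `Q_R(c)` that
is again measurable inside `Q_{R+1}(c)` — the plaquette-specification kernel average `γ_{Q_R(c)} X`, since Wilson's
measure is a DLR state of the plaquette specification and every plaquette through a link of `Q_R(c)` lies in
`Q_{R+1}(c)`. [folklore] -/
theorem exists_local_version_of_stronglyMeasurable {G : Type} [Group G] [TopologicalSpace G]
    [IsTopologicalGroup G] [CompactSpace G] [MeasurableSpace G] [BorelSpace G]
    (r : LatticeRep G) (β : ℝ) (S R : ℕ) (c : Site 4)
    {X : GaugeConfig 4 (2 * S + 1) G → ℝ} {C : ℝ}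
    (hXm : StronglyMeasurable[(cylinderEvents (cubeEdgesT (2 * S + 1) (R + 1) c) :
      MeasurableSpace (GaugeConfig 4 (2 * S + 1) G))] X)
    (hXb : ∀ U, |X U| ≤ C) :
    ∃ g : GaugeConfig 4 (2 * S + 1) G → ℝ,
      StronglyMeasurable[(cylinderEvents (cubeEdgesT (2 * S + 1) (R + 1) c) :
        MeasurableSpace (GaugeConfig 4 (2 * S + 1) G))] g ∧
      g =ᵐ[(wilsonMeasure r.ρ β : Measure (GaugeConfig 4 (2 * S + 1) G))]
        (wilsonMeasure r.ρ β : Measure (GaugeConfig 4 (2 * S + 1) G))[X |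
          (exterior (2 * S + 1) R c : MeasurableSpace (GaugeConfig 4 (2 * S + 1) G))] := by
  haveI : SecondCountableTopology G :=
    (r.continuous.isClosedEmbedding r.injective).isEmbedding.secondCountableTopology
  haveI : T2Space G := (r.continuous.isClosedEmbedding r.injective).isEmbedding.t2Space
  haveI := isProbabilityMeasure_wilsonMeasure (d := 4) (L := 2 * S + 1) r.ρ r.continuous β
  -- the plaquette potential and its Gibbsian specification, of which Wilson's measure is DLR
  obtain ⟨Φ, supp, hΦ, hΦb, hsupp, hH, hstruct⟩ :=
    exists_plaquettePotential (d := 4) (L := 2 * S + 1) r.ρ r.continuous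
  have hμ : Literature.Probability.LatticeModels.IsGibbsMeasure
      (Literature.Probability.LatticeModels.gibbsSpecOfPotential (haarProbability G) Φ supp β)
      (wilsonMeasure (d := 4) (L := 2 * S + 1) r.ρ β) :=
    isGibbsMeasure_wilsonMeasure r.ρ r.continuous hΦ hΦb hsupp hH β
  -- the cube `Q_R(c)` on the torus, a finite link set
  set Λ : Finset (Edge 4 (2 * S + 1)) := (Set.toFinite (cubeEdgesT (2 * S + 1) R c)).toFinset
    with hΛ
  have hΛc : (↑Λ : Set (Edge 4 (2 * S + 1))) = cubeEdgesT (2 * S + 1) R c :=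
    Set.Finite.coe_toFinset _
  -- every interaction set meeting `Λ` lies in the image of `Q_{R+1}(c)`
  have hsuppT : ∀ A ∈ supp Λ, (A ∩ Λ).Nonempty →
      (↑A : Set (Edge 4 (2 * S + 1))) ⊆ ↑Λ ∪ cubeEdgesT (2 * S + 1) (R + 1) c := by
    intro A hA hne
    obtain ⟨y, i', j', -, rfl⟩ := hstruct Λ A hA
    obtain ⟨ε, hε⟩ := hne
    rw [Finset.mem_inter] at hε
    have hεΛ : ε ∈ cubeEdgesT (2 * S + 1) R c := by rw [← hΛc]; exact Finset.mem_coe.2 hε.2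
    obtain ⟨e, ⟨he1, he2⟩, rfl⟩ := hεΛ
    exact (ConditionalMeanTelescoping.plaquetteLinks_subset_image he1 he2 hε.1).trans
      Set.subset_union_right
  -- the observable: measurable, bounded, reads only links in the image of `Q_{R+1}(c)`
  have hXmeas : Measurable X := (hXm.mono cylinderEvents_le_pi).measurable
  have hXdep : DependsOn X (↑Λ ∪ cubeEdgesT (2 * S + 1) (R + 1) c) :=
    (dependsOn_of_measurable_cylinderEvents_real hXm.measurable).mono Set.subset_union_right
  -- the Markov property of the plaquette specification
  obtain ⟨hgm, hgae⟩ := stronglyMeasurable_and_ae_eq_condExp_integral_gibbsSpecOfPotential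
    (haarProbability G) hΦ hΦb hsupp β hμ Λ hsuppT hXmeas hXb hXdep
  rw [hΛc] at hgae
  exact ⟨_, hgm, hgae⟩

/-! ## The registered stub -/

/-- **stub_peelIdentity** — PEELING, as an exact inequality in tree vocabulary.  For every compact gauge group with
lattice representation data `r`, real `β`, torus half-side `S`, blow-up factor `λ ≥ 1`, radius `R`, and `n` plaquettes of
orientations `o k` at base points `x k` pairwise separated by more than `2λR+1` and at most `S` in some coordinate
(`4λR+4 < 2S+1`): the torus `n`-point function of the centred plaquettes is bounded by the expectation of the PRODUCT of
the conditional first moments, given the exteriors of the cubes `Q_{λR}(x k)`, of the absolute conditional means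
`|E[δpₖ | exterior of Q_R(x k)]|`.  Proof route: telescoping through (bounded truncations of) the local versions of the
conditional means (landed `stub_condMeanLocality` + `integral_prod_eq_integral_prod_of_ae_eq_condExp`, radius `R`),
`|∫∏| ≤ ∫∏|·|`, then the same identity once more at radius `λR` with the versions of `E[|g̃ₖ| | ext Q_{λR}(x k)]`
measurable inside `Q_{λR+1}(x k)` supplied by the Markov property
`stronglyMeasurable_and_ae_eq_condExp_integral_gibbsSpecOfPotential`. [folklore] -/
theorem stub_peelIdentity :
    ∀ (G : Type) [Group G] [TopologicalSpace G] [IsTopologicalGroup G] [CompactSpace G]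
        [MeasurableSpace G] [BorelSpace G] (r : LatticeRep G) (β : ℝ) (S lam R n : ℕ)
        (o : Fin n → Fin 4 × Fin 4) (x : Fin n → Site 4),
      1 ≤ lam → 4 * (lam * R) + 4 < 2 * S + 1 →
      (∀ k l, k ≠ l → ∃ μ : Fin 4, (2 * (lam * R) + 1 : ℤ) < |x k μ - x l μ| ∧ |x k μ - x l μ| ≤ S) →
        |∫ U, ∏ k, (torusPlaquette r (2 * S + 1) (o k).1 (o k).2 (x k) U -
              ∫ V, torusPlaquette r (2 * S + 1) (o k).1 (o k).2 (x k) V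
                ∂(wilsonMeasure r.ρ β : Measure (GaugeConfig 4 (2 * S + 1) G)))
            ∂(wilsonMeasure r.ρ β : Measure (GaugeConfig 4 (2 * S + 1) G))| ≤
          ∫ U, ∏ k, ((wilsonMeasure r.ρ β : Measure (GaugeConfig 4 (2 * S + 1) G))[fun U =>
              |((wilsonMeasure r.ρ β : Measure (GaugeConfig 4 (2 * S + 1) G))[fun U =>
                  torusPlaquette r (2 * S + 1) (o k).1 (o k).2 (x k) U -
                    ∫ V, torusPlaquette r (2 * S + 1) (o k).1 (o k).2 (x k) V
                      ∂(wilsonMeasure r.ρ β : Measure (GaugeConfig 4 (2 * S + 1) G)) |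
                (exterior (2 * S + 1) R (x k) : MeasurableSpace (GaugeConfig 4 (2 * S + 1) G))]) U| |
              (exterior (2 * S + 1) (lam * R) (x k) : MeasurableSpace (GaugeConfig 4 (2 * S + 1) G))]) U
            ∂(wilsonMeasure r.ρ β : Measure (GaugeConfig 4 (2 * S + 1) G)) := by
  intro G _ _ _ _ _ _ r β S lam R n o x hlam hRS hsep
  haveI : SecondCountableTopology G :=
    (r.continuous.isClosedEmbedding r.injective).isEmbedding.secondCountableTopology
  haveI := isProbabilityMeasure_wilsonMeasure (d := 4) (L := 2 * S + 1) r.ρ r.continuous β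
  set μW := (wilsonMeasure r.ρ β : Measure (GaugeConfig 4 (2 * S + 1) G)) with hμW
  -- separation at radius `R ≤ λR` and at radius `λR`
  have hRM : R ≤ lam * R := Nat.le_mul_of_pos_left R hlam
  have hRS' : 4 * R + 4 < 2 * S + 1 := by omega
  have hsep1 : ∀ k l, k ≠ l →
      ∃ μ : Fin 4, (2 * R + 1 : ℤ) < |x k μ - x l μ| ∧ |x k μ - x l μ| ≤ S := by
    intro k l hkl
    obtain ⟨μ, h1, h2⟩ := hsep k l hkl
    refine ⟨μ, lt_of_le_of_lt ?_ h1, h2⟩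
    have : (R : ℤ) ≤ (lam : ℤ) * R := by exact_mod_cast hRM
    linarith
  have hsep2 : ∀ k l, k ≠ l →
      ∃ μ : Fin 4, (2 * ((lam * R : ℕ) : ℤ) + 1) < |x k μ - x l μ| ∧ |x k μ - x l μ| ≤ S := by
    intro k l hkl
    obtain ⟨μ, h1, h2⟩ := hsep k l hkl
    exact ⟨μ, by push_cast; exact h1, h2⟩
  -- the centred plaquettes
  set X : Fin n → GaugeConfig 4 (2 * S + 1) G → ℝ := fun k U =>
    torusPlaquette r (2 * S + 1) (o k).1 (o k).2 (x k) U -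
      ∫ V, torusPlaquette r (2 * S + 1) (o k).1 (o k).2 (x k) V ∂μW with hX
  have hXm : ∀ k, StronglyMeasurable[(cylinderEvents (cubeEdgesT (2 * S + 1) (R + 1) (x k)) :
      MeasurableSpace (GaugeConfig 4 (2 * S + 1) G))] (X k) := fun k =>
    stronglyMeasurable_plaquetteObs_torusLift_sub r.ρ r.continuous (2 * S + 1) (M := R + 1)
      le_add_self (x k) (o k).1 (o k).2 _
  have hXb : ∀ k U, |X k U| ≤ 2 * (r.N : ℝ) := fun k U =>
    abs_plaquetteObs_torusLift_sub_integral_le r.ρ r.mem_unitary (2 * S + 1) (x k) (o k).1 (o k).2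
      μW U
  -- (1) local versions of the conditional means at radius `R`, truncated at height `2N`
  choose g hgm hgae using fun k =>
    ConditionalMeanTelescoping.stub_condMeanLocality G r β S R (x k) (o k).1 (o k).2
  have hgm' : ∀ k, StronglyMeasurable[(cylinderEvents (cubeEdgesT (2 * S + 1) (R + 1) (x k)) :
      MeasurableSpace (GaugeConfig 4 (2 * S + 1) G))] (g k) := fun k => hgm k
  have hgae' : ∀ k, g k =ᵐ[μW]
      μW[X k | (exterior (2 * S + 1) R (x k) : MeasurableSpace (GaugeConfig 4 (2 * S + 1) G))] :=
    fun k => hgae k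
  choose gt hgtm hgtb' hgteq using fun k => exists_stronglyMeasurable_truncation (hgm' k) (2 * (r.N : ℝ))
  have hgtb : ∀ k U, |gt k U| ≤ 2 * (r.N : ℝ) := fun k U =>
    (hgtb' k U).trans_eq (abs_of_nonneg (by positivity))
  have hgtae : ∀ k, gt k =ᵐ[μW]
      μW[X k | (exterior (2 * S + 1) R (x k) : MeasurableSpace (GaugeConfig 4 (2 * S + 1) G))] := by
    intro k
    have hbd : ∀ᵐ U ∂μW, |(μW[X k |
        (exterior (2 * S + 1) R (x k) : MeasurableSpace (GaugeConfig 4 (2 * S + 1) G))]) U| ≤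
          2 * (r.N : ℝ) :=
      ae_bdd_abs_condExp_of_ae_bdd_abs (Eventually.of_forall (hXb k))
    filter_upwards [hgae' k, hbd] with U hU1 hU2
    rw [← hU1] at hU2 ⊢
    exact hgteq k U hU2
  have key1 : ∫ U, ∏ k, X k U ∂μW = ∫ U, ∏ k, gt k U ∂μW :=
    integral_prod_eq_integral_prod_of_ae_eq_condExp (μ := μW)
      (fun k => (cylinderEvents (cubeEdgesT (2 * S + 1) (R + 1) (x k)) :
        MeasurableSpace (GaugeConfig 4 (2 * S + 1) G)))
      (fun k => (exterior (2 * S + 1) R (x k) : MeasurableSpace (GaugeConfig 4 (2 * S + 1) G)))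
      (fun _ => cylinderEvents_le_pi) (fun _ => cylinderEvents_le_pi)
      (fun k l hkl =>
        cylinderEvents_mono (image_torusEdge_linkCube_succ_subset_compl hRS' (hsep1 k l hkl)))
      (X := X) (g := gt) (B := 2 * r.N) hXm hXb hgtm hgtae
  -- (3) the absolute truncated versions: bounded, measurable inside `Q_{λR+1}`, and their local
  -- conditional means at radius `λR`
  have hle : R + 1 ≤ lam * R + 1 := Nat.succ_le_succ hRM
  have hX'm : ∀ k, StronglyMeasurable[(cylinderEvents (cubeEdgesT (2 * S + 1) (lam * R + 1) (x k)) :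
      MeasurableSpace (GaugeConfig 4 (2 * S + 1) G))] (fun U => |gt k U|) := fun k =>
    continuous_abs.comp_stronglyMeasurable
      ((hgtm k).mono (cylinderEvents_mono (Set.image_mono (linkCube_mono hle (x k)))))
  have hX'b : ∀ k U, |(fun U => |gt k U|) U| ≤ 2 * (r.N : ℝ) := fun k U =>
    (le_of_eq (abs_abs _)).trans (hgtb k U)
  choose g' hg'm hg'ae using fun k =>
    exists_local_version_of_stronglyMeasurable r β S (lam * R) (x k) (hX'm k) (hX'b k)
  have key2 : ∫ U, ∏ k, |gt k U| ∂μW = ∫ U, ∏ k, g' k U ∂μW :=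
    integral_prod_eq_integral_prod_of_ae_eq_condExp (μ := μW)
      (fun k => (cylinderEvents (cubeEdgesT (2 * S + 1) (lam * R + 1) (x k)) :
        MeasurableSpace (GaugeConfig 4 (2 * S + 1) G)))
      (fun k => (exterior (2 * S + 1) (lam * R) (x k) : MeasurableSpace (GaugeConfig 4 (2 * S + 1) G)))
      (fun _ => cylinderEvents_le_pi) (fun _ => cylinderEvents_le_pi)
      (fun k l hkl =>
        cylinderEvents_mono (image_torusEdge_linkCube_succ_subset_compl hRS (hsep2 k l hkl)))
      (X := fun k U => |gt k U|) (g := g') (B := 2 * r.N) hX'm hX'b hg'm hg'ae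
  -- (4) the local versions are a.e. the stated conditional means
  have key3 : ∫ U, ∏ k, g' k U ∂μW =
      ∫ U, ∏ k, (μW[fun U => |(μW[X k |
          (exterior (2 * S + 1) R (x k) : MeasurableSpace (GaugeConfig 4 (2 * S + 1) G))]) U| |
        (exterior (2 * S + 1) (lam * R) (x k) : MeasurableSpace (GaugeConfig 4 (2 * S + 1) G))]) U
        ∂μW := by
    refine integral_congr_ae ?_
    have hall : ∀ᵐ U ∂μW, ∀ k, g' k U = (μW[fun U => |(μW[X k |
          (exterior (2 * S + 1) R (x k) : MeasurableSpace (GaugeConfig 4 (2 * S + 1) G))]) U| |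
        (exterior (2 * S + 1) (lam * R) (x k) : MeasurableSpace (GaugeConfig 4 (2 * S + 1) G))]) U := by
      refine eventually_all.2 fun k => ?_
      have h1 : (fun U => |gt k U|) =ᵐ[μW] fun U => |(μW[X k |
          (exterior (2 * S + 1) R (x k) : MeasurableSpace (GaugeConfig 4 (2 * S + 1) G))]) U| := by
        filter_upwards [hgtae k] with U hU
        rw [hU]
      exact (hg'ae k).trans (condExp_congr_ae h1)
    filter_upwards [hall] with U hU
    exact Finset.prod_congr rfl fun k _ => hU k
  -- (2) and assembly
  calc |∫ U, ∏ k, X k U ∂μW| = |∫ U, ∏ k, gt k U ∂μW| := by rw [key1]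
    _ ≤ ∫ U, |∏ k, gt k U| ∂μW := abs_integral_le_integral_abs
    _ = ∫ U, ∏ k, |gt k U| ∂μW := by simp only [Finset.abs_prod]
    _ = ∫ U, ∏ k, g' k U ∂μW := key2
    _ = _ := key3

end Summit.QuantumFields.YangMills.Cruxes.HypercubicLimit.PeelAndDisseminate
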